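import Mathlib
import Literature.MathematicalPhysics.StatisticalMechanics.LennardJonesClusters
import Literature.MathematicalPhysics.StatisticalMechanics.LocalMatchingCompactness
import Summits.AtomisticToContinuum.Crystallization.Theorems.BraggSlacknessRigidityHcpDiffractionRigidityDenseCentresAux2

/-!
# Uniform Gaussian sums and tails over separated configurations (local-limit stub of
# `HcpDiffractionRigidity`, item `stmt-AtomisticToContinuum-13166`, stub `stub_localLimitTransfer`,
# Aux file 1)

The engine of the analytic part of stub B1 (transfer of Gaussian quietness to a local limit):
Gaussian weights `exp(-|z|²/L²)` summed over a `δ`-separated configuration of `ℝ³` are bounded,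
and their tails `|z| > R` are small, UNIFORMLY over all `δ`-separated configurations (finite
families `Fin N → ℝ³` or finite subsets of a `δ`-separated set `Λ`).

* `sum_exp_neg_mul_sq_le` — `∑ᵢ e^{-a|yᵢ|²} ≤ 2(2/δ+1)³(4π/a+1)³` (reduce to the Gaussian shell
  sums `HcpRigidityDenseCentres.sum_exp_le` centred at the particle closest to the origin);
* `sum_gauss_le` — the same for the weights `exp(-|z|²/L²)`;
* `exists_radius_tail_le` — uniform tails: for `η > 0` a radius `R` with
  `∑_{|yᵢ| > R} e^{-|yᵢ|²/L²} ≤ η` for every `δ`-separated `y`;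
* `sum_finset_le_of_forall`, `summable_of_forall_sum_le` — transfer of such uniform bounds to
  finite subsets of a `δ`-separated set `Λ ⊆ ℝ³`, summability over `Λ` and the `tsum` bound.

All `[folklore]`.
-/

noncomputable section

namespace Summit.AtomisticToContinuum.Crystallization.Theorems

namespace HcpRigidityLocalLimit

open Filter Metric Set
open scoped BigOperators Topology
open Literature.MathematicalPhysics.StatisticalMechanics
open Summit.AtomisticToContinuum.Crystallization.Theorems.HcpRigidityDenseCentres

/-! ## Uniform Gaussian sums -/

/-- **Uniform Gaussian sums.** For a `δ`-separated finite configuration `y` of `ℝ³` and `a > 0`,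
`∑ᵢ e^{-a|yᵢ|²} ≤ 2(2/δ+1)³(4π/a+1)³` (compare with the shell sums about the particle closest to the
origin: `|yᵢ - yₖ| ≤ 2|yᵢ|`). [folklore] -/
theorem sum_exp_neg_mul_sq_le {N : ℕ} (y : Fin N → EuclideanSpace ℝ (Fin 3)) {δ : ℝ} (hδ : 0 < δ)
    (hsep : ∀ i j, i ≠ j → δ ≤ dist (y i) (y j)) {a : ℝ} (ha : 0 < a) :
    ∑ i, Real.exp (-a * ‖y i‖ ^ 2) ≤ 2 * (2 / δ + 1) ^ 3 * (4 * Real.pi / a + 1) ^ 3 := by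
  rcases isEmpty_or_nonempty (Fin N) with hN | hN
  · simp only [Finset.univ_eq_empty, Finset.sum_empty]; positivity
  obtain ⟨k, -, hk⟩ := Finset.exists_min_image Finset.univ (fun i => ‖y i‖) Finset.univ_nonempty
  set s : ℝ := 4 * Real.pi / a + 1 with hs
  have hs0 : 0 < 4 * Real.pi / a := by positivity
  have hs1 : 1 ≤ s := by rw [hs]; linarith
  refine le_trans (Finset.sum_le_sum fun i _ => ?_) (sum_exp_le y hδ hsep k hs1)
  rw [Real.exp_le_exp]
  have h1 : ‖y i - y k‖ ≤ 2 * ‖y i‖ := by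
    have := hk i (Finset.mem_univ i)
    calc ‖y i - y k‖ ≤ ‖y i‖ + ‖y k‖ := norm_sub_le _ _
      _ ≤ 2 * ‖y i‖ := by linarith
  have h2 : ‖y i - y k‖ ^ 2 ≤ 4 * ‖y i‖ ^ 2 := by nlinarith [norm_nonneg (y i - y k)]
  have h3 : Real.pi / s ^ 2 ≤ a / 4 := by
    rw [div_le_iff₀ (by positivity)]
    have e : Real.pi = a / 4 * (s - 1) := by rw [hs]; field_simp; ring
    have : 0 ≤ s ^ 2 - (s - 1) := by nlinarith
    nlinarith [mul_nonneg ha.le this]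
  have h5 : Real.pi / s ^ 2 * ‖y i - y k‖ ^ 2 ≤ a / 4 * (4 * ‖y i‖ ^ 2) :=
    mul_le_mul h3 h2 (sq_nonneg _) (by positivity)
  nlinarith [h5]

/-- **Uniform Gaussian sums, scale form.** For a `δ`-separated finite configuration `y` of `ℝ³` and
`L > 0`, `∑ᵢ e^{-|yᵢ|²/L²} ≤ 2(2/δ+1)³(4πL²+1)³`. [folklore] -/
theorem sum_gauss_le {N : ℕ} (y : Fin N → EuclideanSpace ℝ (Fin 3)) {δ : ℝ} (hδ : 0 < δ)
    (hsep : ∀ i j, i ≠ j → δ ≤ dist (y i) (y j)) {L : ℝ} (hL : 0 < L) :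
    ∑ i, Real.exp (-(‖y i‖ ^ 2) / L ^ 2) ≤ 2 * (2 / δ + 1) ^ 3 * (4 * Real.pi * L ^ 2 + 1) ^ 3 := by
  have h := sum_exp_neg_mul_sq_le y hδ hsep (a := (L ^ 2)⁻¹) (by positivity)
  have e1 : ∀ z : EuclideanSpace ℝ (Fin 3),
      Real.exp (-(‖z‖ ^ 2) / L ^ 2) = Real.exp (-(L ^ 2)⁻¹ * ‖z‖ ^ 2) :=
    fun z => by congr 1; ring
  have e2 : 4 * Real.pi / (L ^ 2)⁻¹ = 4 * Real.pi * L ^ 2 := by rw [div_inv_eq_mul]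
  simp_rw [e1]
  rwa [e2] at h

/-- **Uniform Gaussian tails.** For `δ > 0`, `L > 0` and `η > 0` there is a radius `R` such that
`∑_{|yᵢ| > R} e^{-|yᵢ|²/L²} ≤ η` for EVERY `δ`-separated finite configuration `y` of `ℝ³`
(`e^{-|y|²/L²} ≤ e^{-R²/2L²} e^{-|y|²/2L²}` beyond radius `R`, and the uniform bound at scale
`√2 L`). [folklore] -/
theorem exists_radius_tail_le {δ : ℝ} (hδ : 0 < δ) {L : ℝ} (hL : 0 < L) {η : ℝ} (hη : 0 < η) :
    ∃ R : ℝ, ∀ (N : ℕ) (y : Fin N → EuclideanSpace ℝ (Fin 3)),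
      (∀ i j, i ≠ j → δ ≤ dist (y i) (y j)) →
      ∑ i, (if R < ‖y i‖ then Real.exp (-(‖y i‖ ^ 2) / L ^ 2) else 0) ≤ η := by
  set a : ℝ := (L ^ 2)⁻¹ with ha
  have ha0 : 0 < a := by positivity
  set B : ℝ := 2 * (2 / δ + 1) ^ 3 * (4 * Real.pi / (a / 2) + 1) ^ 3 with hB
  have ht : Tendsto (fun R : ℝ => Real.exp (-(a / 2) * R ^ 2) * B) atTop (𝓝 (0 * B)) := by
    refine (Real.tendsto_exp_atBot.comp ?_).mul_const B
    have : Tendsto (fun R : ℝ => -((a / 2) * R ^ 2)) atTop atBot :=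
      tendsto_neg_atTop_atBot.comp ((tendsto_pow_atTop two_ne_zero).const_mul_atTop (half_pos ha0))
    simpa only [neg_mul] using this
  rw [zero_mul] at ht
  obtain ⟨R, hR0, hR⟩ :=
    ((eventually_ge_atTop (0 : ℝ)).and (ht.eventually (gt_mem_nhds hη))).exists
  refine ⟨R, fun N y hsep => ?_⟩
  have e1 : ∀ z : EuclideanSpace ℝ (Fin 3),
      Real.exp (-(‖z‖ ^ 2) / L ^ 2) = Real.exp (-a * ‖z‖ ^ 2) :=
    fun z => by congr 1; rw [ha]; ring
  have key : ∀ i, (if R < ‖y i‖ then Real.exp (-(‖y i‖ ^ 2) / L ^ 2) else 0) ≤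
      Real.exp (-(a / 2) * R ^ 2) * Real.exp (-(a / 2) * ‖y i‖ ^ 2) := by
    intro i
    split_ifs with h
    · rw [e1, ← Real.exp_add, Real.exp_le_exp]
      have : R ^ 2 ≤ ‖y i‖ ^ 2 := pow_le_pow_left₀ hR0 h.le 2
      nlinarith [mul_le_mul_of_nonneg_left this ha0.le]
    · positivity
  calc ∑ i, (if R < ‖y i‖ then Real.exp (-(‖y i‖ ^ 2) / L ^ 2) else 0)
      ≤ ∑ i, Real.exp (-(a / 2) * R ^ 2) * Real.exp (-(a / 2) * ‖y i‖ ^ 2) :=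
        Finset.sum_le_sum fun i _ => key i
    _ = Real.exp (-(a / 2) * R ^ 2) * ∑ i, Real.exp (-(a / 2) * ‖y i‖ ^ 2) := by
        rw [Finset.mul_sum]
    _ ≤ Real.exp (-(a / 2) * R ^ 2) * B := by
        gcongr
        exact sum_exp_neg_mul_sq_le y hδ hsep (half_pos ha0)
    _ ≤ η := hR.le

/-! ## Transfer to finite subsets of a separated set -/

/-- A bound valid for all `δ`-separated finite configurations `Fin N → ℝ³` holds for the sum over
any finite subset of a `δ`-separated set `Λ ⊆ ℝ³` (enumerate the subset). [folklore] -/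
theorem sum_finset_le_of_forall {Λ : Set (EuclideanSpace ℝ (Fin 3))} {δ : ℝ}
    (hΛ : ∀ p ∈ Λ, ∀ q ∈ Λ, p ≠ q → δ ≤ dist p q) {g : EuclideanSpace ℝ (Fin 3) → ℝ} {B : ℝ}
    (hB : ∀ (N : ℕ) (y : Fin N → EuclideanSpace ℝ (Fin 3)),
      (∀ i j, i ≠ j → δ ≤ dist (y i) (y j)) → ∑ i, g (y i) ≤ B)
    (T : Finset Λ) : ∑ s ∈ T, g s ≤ B := by
  classical
  set e := T.equivFin with he
  have hsepT : ∀ i j : Fin T.card, i ≠ j →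
      δ ≤ dist (((e.symm i : T) : Λ) : EuclideanSpace ℝ (Fin 3))
        (((e.symm j : T) : Λ) : EuclideanSpace ℝ (Fin 3)) := by
    intro i j hij
    refine hΛ _ (e.symm i).1.2 _ (e.symm j).1.2 fun h => hij ?_
    exact e.symm.injective (Subtype.ext (Subtype.ext h))
  have h1 := hB T.card (fun i => (((e.symm i : T) : Λ) : EuclideanSpace ℝ (Fin 3))) hsepT
  have h2 : ∑ i : Fin T.card, g (((e.symm i : T) : Λ) : EuclideanSpace ℝ (Fin 3)) =
      ∑ t : T, g ((t : Λ) : EuclideanSpace ℝ (Fin 3)) :=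
    e.symm.sum_comp (fun t : T => g ((t : Λ) : EuclideanSpace ℝ (Fin 3)))
  rw [h2, Finset.sum_coe_sort T (fun s : Λ => g (s : EuclideanSpace ℝ (Fin 3)))] at h1
  exact h1

/-- Hence a non-negative weight with uniformly bounded sums over `δ`-separated finite
configurations is summable over any `δ`-separated set `Λ`, with the same bound for the sum.
[folklore] -/
theorem summable_of_forall_sum_le {Λ : Set (EuclideanSpace ℝ (Fin 3))} {δ : ℝ}
    (hΛ : ∀ p ∈ Λ, ∀ q ∈ Λ, p ≠ q → δ ≤ dist p q) {g : EuclideanSpace ℝ (Fin 3) → ℝ}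
    (hg : ∀ z, 0 ≤ g z) {B : ℝ}
    (hB : ∀ (N : ℕ) (y : Fin N → EuclideanSpace ℝ (Fin 3)),
      (∀ i j, i ≠ j → δ ≤ dist (y i) (y j)) → ∑ i, g (y i) ≤ B) :
    Summable (fun s : Λ => g s) ∧ ∑' s : Λ, g s ≤ B :=
  ⟨summable_of_sum_le (fun _ => hg _) fun T => sum_finset_le_of_forall hΛ hB T,
    Real.tsum_le_of_sum_le (fun _ => hg _) fun T => sum_finset_le_of_forall hΛ hB T⟩

/-- The Gaussian weights `e^{-|s|²/L²}` are summable over a `δ`-separated set `Λ ⊆ ℝ³`, with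
`∑' e^{-|s|²/L²} ≤ 2(2/δ+1)³(4πL²+1)³`. [folklore] -/
theorem summable_gauss {Λ : Set (EuclideanSpace ℝ (Fin 3))} {δ : ℝ} (hδ : 0 < δ)
    (hΛ : ∀ p ∈ Λ, ∀ q ∈ Λ, p ≠ q → δ ≤ dist p q) {L : ℝ} (hL : 0 < L) :
    Summable (fun s : Λ => Real.exp (-(‖(s : EuclideanSpace ℝ (Fin 3))‖ ^ 2) / L ^ 2)) ∧
      ∑' s : Λ, Real.exp (-(‖(s : EuclideanSpace ℝ (Fin 3))‖ ^ 2) / L ^ 2) ≤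
        2 * (2 / δ + 1) ^ 3 * (4 * Real.pi * L ^ 2 + 1) ^ 3 :=
  summable_of_forall_sum_le
    (g := fun z : EuclideanSpace ℝ (Fin 3) => Real.exp (-(‖z‖ ^ 2) / L ^ 2)) hΛ
    (fun _ => (Real.exp_pos _).le) fun _ y hs => sum_gauss_le y hδ hs hL

/-! ## Local convergence of sums over locally convergent separated configurations -/

/-- **Local convergence implies convergence of sums of compactly supported continuous test
functions.** If `δ`-separated finite configurations `z k` converge locally to a `δ`-separated set
`Λ` (two-way `ε`-matching on every ball about `0`, eventually in `k`), then
`∑ᵢ f(z k i) → ∑' s : Λ, f s` for every continuous compactly supported `f` (for small `ε` the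
matching is a bijection near the support; uniform continuity of `f`). [folklore] -/
theorem tendsto_sum_of_near_of_hasCompactSupport {F : Type*} [NormedAddCommGroup F]
    {m : ℕ → ℕ} (z : (k : ℕ) → Fin (m k) → EuclideanSpace ℝ (Fin 3))
    (Λ : Set (EuclideanSpace ℝ (Fin 3))) {δ : ℝ} (hδ : 0 < δ)
    (hsep : ∀ k i i', i ≠ i' → δ ≤ dist (z k i) (z k i'))
    (hΛ : ∀ p ∈ Λ, ∀ q ∈ Λ, p ≠ q → δ ≤ dist p q)
    (h : ∀ R ε : ℝ, 0 < ε → ∀ᶠ k in atTop,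
        (∀ p ∈ Λ, ‖p‖ ≤ R → ∃ i, dist (z k i) p ≤ ε) ∧
        (∀ i, ‖z k i‖ ≤ R → ∃ p ∈ Λ, dist (z k i) p ≤ ε))
    {f : EuclideanSpace ℝ (Fin 3) → F} (hfc : Continuous f) (hf : HasCompactSupport f) :
    Tendsto (fun k => ∑ i, f (z k i)) atTop (𝓝 (∑' s : Λ, f s)) := by
  classical
  obtain ⟨R₀, hR₀⟩ := hf.isCompact.isBounded.subset_closedBall 0
  -- the finitely many points of `Λ` in the ball of radius `R₀ + 1`
  have hfin : (Λ ∩ closedBall 0 (R₀ + 1)).Finite :=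
    finite_of_forall_le_dist_of_subset_closedBall hδ
      (fun p hp q hq hpq => hΛ p hp.1 q hq.1 hpq) inter_subset_right
  have hfin' : {s : Λ | ‖(s : EuclideanSpace ℝ (Fin 3))‖ ≤ R₀ + 1}.Finite := by
    refine (hfin.preimage Subtype.val_injective.injOn).subset fun s hs => ?_
    exact ⟨s.2, mem_closedBall_zero_iff.2 hs⟩
  set T : Finset Λ := hfin'.toFinset with hT
  have hTmem : ∀ s : Λ, s ∈ T ↔ ‖(s : EuclideanSpace ℝ (Fin 3))‖ ≤ R₀ + 1 := fun s => by simp [hT]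
  have hL : ∑' s : Λ, f s = ∑ s ∈ T, f s := by
    refine tsum_eq_sum fun s hs => ?_
    rw [hTmem, not_le] at hs
    exact image_eq_zero_of_notMem_tsupport fun h' => by
      have := mem_closedBall_zero_iff.1 (hR₀ h')
      linarith
  rw [hL]
  refine Metric.tendsto_atTop.2 fun η hη => ?_
  -- uniform continuity of `f` at scale `η / (#T + 1)`
  obtain ⟨θ, hθ, hθf⟩ := Metric.uniformContinuous_iff.1 (hf.uniformContinuous_of_continuous hfc)
    (η / (T.card + 1)) (by positivity)
  set ε := min (θ / 2) (min (δ / 3) 1) with hε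
  have hε0 : 0 < ε := lt_min (by linarith) (lt_min (by linarith) one_pos)
  have hεθ : ε < θ := (min_le_left _ _).trans_lt (by linarith)
  have hεδ : 2 * ε < δ := by
    have : ε ≤ δ / 3 := (min_le_right _ _).trans (min_le_left _ _)
    linarith
  have hε1 : ε ≤ 1 := (min_le_right _ _).trans (min_le_right _ _)
  obtain ⟨K, hK⟩ := eventually_atTop.1 (h (R₀ + 1) ε hε0)
  refine ⟨K, fun k hk => ?_⟩
  obtain ⟨hA, hB⟩ := hK k hk
  rcases isEmpty_or_nonempty (Fin (m k)) with hemp | hnon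
  · -- no particles: then no points of `Λ` near the support either
    have hT0 : T = ∅ := Finset.eq_empty_of_forall_notMem fun s hs => by
      obtain ⟨i, -⟩ := hA s s.2 ((hTmem s).1 hs)
      exact isEmptyElim i
    simp [hT0, hη]
  -- the particle matched to each point of `T`
  choose! ι hι using fun (s : Λ) (hs : s ∈ T) => hA s s.2 ((hTmem s).1 hs)
  have hinj : ∀ s ∈ T, ∀ s' ∈ T, ι s = ι s' → s = s' := by
    intro s hs s' hs' hss'
    by_contra hne
    have hne' : (s : EuclideanSpace ℝ (Fin 3)) ≠ s' := fun h => hne (Subtype.ext h)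
    have h1 := hΛ s s.2 s' s'.2 hne'
    have : dist (s : EuclideanSpace ℝ (Fin 3)) s' ≤ 2 * ε :=
      calc dist (s : EuclideanSpace ℝ (Fin 3)) s'
          ≤ dist (s : EuclideanSpace ℝ (Fin 3)) (z k (ι s)) + dist (z k (ι s)) s' :=
            dist_triangle _ _ _
        _ ≤ ε + ε := add_le_add (by rw [dist_comm]; exact hι s hs) (by rw [hss']; exact hι s' hs')
        _ = 2 * ε := by ring
    linarith
  -- unmatched particles do not see `f`
  have hzero : ∀ i ∈ (Finset.univ : Finset (Fin (m k))), i ∉ T.image ι → f (z k i) = 0 := by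
    intro i _ hi
    by_contra hfi
    have hyR : ‖z k i‖ ≤ R₀ := mem_closedBall_zero_iff.1 (hR₀ (subset_tsupport _ hfi))
    obtain ⟨p, hpΛ, hdp⟩ := hB i (by linarith)
    have hpR : ‖p‖ ≤ R₀ + 1 := by
      have h1 := norm_sub_norm_le p (z k i)
      rw [← dist_eq_norm, dist_comm] at h1
      linarith
    have hsT : (⟨p, hpΛ⟩ : Λ) ∈ T := (hTmem _).2 hpR
    have his : i = ι ⟨p, hpΛ⟩ := by
      by_contra hne
      have h1 := hsep k i (ι ⟨p, hpΛ⟩) hne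
      have : dist (z k i) (z k (ι ⟨p, hpΛ⟩)) ≤ 2 * ε :=
        calc dist (z k i) (z k (ι ⟨p, hpΛ⟩))
            ≤ dist (z k i) p + dist p (z k (ι ⟨p, hpΛ⟩)) := dist_triangle _ _ _
          _ ≤ ε + ε := add_le_add hdp (by rw [dist_comm]; exact hι ⟨p, hpΛ⟩ hsT)
          _ = 2 * ε := by ring
      linarith
    exact hi (Finset.mem_image.2 ⟨⟨p, hpΛ⟩, hsT, his.symm⟩)
  have hsum : ∑ i, f (z k i) = ∑ s ∈ T, f (z k (ι s)) := by
    rw [← Finset.sum_subset (Finset.subset_univ (T.image ι)) hzero, Finset.sum_image hinj]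
  rw [hsum, dist_eq_norm]
  have hterm : ∀ s ∈ T, ‖f (z k (ι s)) - f s‖ < η / (T.card + 1) := fun s hs => by
    have := hθf ((hι s hs).trans_lt hεθ)
    rwa [dist_eq_norm] at this
  calc ‖∑ s ∈ T, f (z k (ι s)) - ∑ s ∈ T, f s‖ = ‖∑ s ∈ T, (f (z k (ι s)) - f s)‖ := by
        rw [Finset.sum_sub_distrib]
    _ ≤ ∑ s ∈ T, ‖f (z k (ι s)) - f s‖ := norm_sum_le _ _
    _ ≤ ∑ _s ∈ T, η / (T.card + 1) := Finset.sum_le_sum fun s hs => (hterm s hs).le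
    _ = T.card * (η / (T.card + 1)) := by rw [Finset.sum_const, nsmul_eq_mul]
    _ = η * (T.card / (T.card + 1)) := by ring
    _ < η * 1 := by
        refine mul_lt_mul_of_pos_left ?_ hη
        rw [div_lt_one (by positivity)]
        linarith
    _ = η := mul_one η

/-- **Local convergence implies convergence of sums of Gaussian-dominated continuous test
functions.** Under the same local convergence of `δ`-separated configurations `z k` to the
`δ`-separated set `Λ`, `∑ᵢ f(z k i) → ∑' s : Λ, f s` for every continuous `f` with
`‖f z‖ ≤ C e^{-|z|²/L²}` (`L > 0`): cut `f` off continuously outside a large ball; the compactly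
supported part converges by `tendsto_sum_of_near_of_hasCompactSupport`, and the remainder is small
on both sides, uniformly, by the uniform Gaussian tails `exists_radius_tail_le`. [folklore] -/
theorem tendsto_sum_of_near_of_gauss {F : Type*} [NormedAddCommGroup F] [NormedSpace ℝ F]
    [CompleteSpace F] {m : ℕ → ℕ} (z : (k : ℕ) → Fin (m k) → EuclideanSpace ℝ (Fin 3))
    (Λ : Set (EuclideanSpace ℝ (Fin 3))) {δ : ℝ} (hδ : 0 < δ)
    (hsep : ∀ k i i', i ≠ i' → δ ≤ dist (z k i) (z k i'))
    (hΛ : ∀ p ∈ Λ, ∀ q ∈ Λ, p ≠ q → δ ≤ dist p q)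
    (h : ∀ R ε : ℝ, 0 < ε → ∀ᶠ k in atTop,
        (∀ p ∈ Λ, ‖p‖ ≤ R → ∃ i, dist (z k i) p ≤ ε) ∧
        (∀ i, ‖z k i‖ ≤ R → ∃ p ∈ Λ, dist (z k i) p ≤ ε))
    {L C : ℝ} (hL : 0 < L) {f : EuclideanSpace ℝ (Fin 3) → F} (hfc : Continuous f)
    (hdom : ∀ x, ‖f x‖ ≤ C * Real.exp (-(‖x‖ ^ 2) / L ^ 2)) :
    Tendsto (fun k => ∑ i, f (z k i)) atTop (𝓝 (∑' s : Λ, f s)) := by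
  classical
  set w : EuclideanSpace ℝ (Fin 3) → ℝ := fun x => Real.exp (-(‖x‖ ^ 2) / L ^ 2) with hw
  have hw0 : ∀ x, 0 < w x := fun x => Real.exp_pos _
  have hC : 0 ≤ C := by
    have := (norm_nonneg (f 0)).trans (hdom 0)
    simpa using this
  obtain ⟨hwsum, -⟩ := summable_gauss hδ hΛ hL
  refine Metric.tendsto_atTop.2 fun η hη => ?_
  set η' : ℝ := η / (2 * C + 2) with hη'
  have hη'0 : 0 < η' := by positivity
  obtain ⟨R, hR⟩ := exists_radius_tail_le hδ hL hη'0
  -- a continuous cutoff equal to `1` on the ball of radius `R`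
  obtain ⟨χ, hχ1, -, hχc, hχ01⟩ := exists_continuous_one_zero_of_isCompact
    (isCompact_closedBall (0 : EuclideanSpace ℝ (Fin 3)) R)
    (isOpen_ball (x := (0 : EuclideanSpace ℝ (Fin 3))) (ε := R + 1)).isClosed_compl
    (disjoint_compl_right_iff_subset.2 (closedBall_subset_ball (by linarith)))
  set g : EuclideanSpace ℝ (Fin 3) → F := fun x => χ x • f x with hg
  set r : EuclideanSpace ℝ (Fin 3) → F := fun x => f x - g x with hr
  set t : EuclideanSpace ℝ (Fin 3) → ℝ := fun x => if R < ‖x‖ then w x else 0 with ht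
  have hgc : Continuous g := χ.continuous.smul hfc
  have hgs : HasCompactSupport g := hχc.smul_right
  have ht0 : ∀ x, 0 ≤ t x := fun x => by
    simp only [ht]; split_ifs <;> [exact (hw0 x).le; exact le_rfl]
  have htw : ∀ x, t x ≤ w x := fun x => by
    simp only [ht]; split_ifs <;> [exact le_rfl; exact (hw0 x).le]
  have hr_le : ∀ x, ‖r x‖ ≤ C * t x := by
    intro x
    by_cases hx : R < ‖x‖
    · have e : r x = (1 - χ x) • f x := by simp only [hr, hg]; rw [sub_smul, one_smul]
      have h01 := hχ01 x
      have hn : ‖1 - χ x‖ ≤ 1 := by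
        rw [Real.norm_eq_abs, abs_of_nonneg (by linarith [h01.2])]
        linarith [h01.1]
      have htx : t x = w x := by simp only [ht, if_pos hx]
      rw [e, norm_smul, htx]
      calc ‖1 - χ x‖ * ‖f x‖ ≤ 1 * ‖f x‖ := by gcongr
        _ ≤ C * w x := by rw [one_mul]; exact hdom x
    · have hxR : x ∈ closedBall (0 : EuclideanSpace ℝ (Fin 3)) R :=
        mem_closedBall_zero_iff.2 (not_lt.1 hx)
      have h1 : χ x = 1 := by simpa using hχ1 hxR
      have htx : t x = 0 := by simp only [ht, if_neg hx]
      simp [hr, hg, h1, htx]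
  -- tails of the finite configurations
  have hfin_tail : ∀ k, ‖∑ i, r (z k i)‖ ≤ C * η' := fun k =>
    calc ‖∑ i, r (z k i)‖ ≤ ∑ i, ‖r (z k i)‖ := norm_sum_le _ _
      _ ≤ ∑ i, C * t (z k i) := Finset.sum_le_sum fun i _ => hr_le _
      _ = C * ∑ i, t (z k i) := by rw [Finset.mul_sum]
      _ ≤ C * η' := by gcongr; exact hR (m k) (z k) (hsep k)
  -- tails of `Λ`
  have htsum : Summable (fun s : Λ => t s) := hwsum.of_nonneg_of_le (fun s => ht0 _) fun s => htw _
  have htail : ∑' s : Λ, t s ≤ η' :=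
    Real.tsum_le_of_sum_le (fun s => ht0 _) fun T => sum_finset_le_of_forall hΛ hR T
  have hfsum : Summable (fun s : Λ => f s) :=
    Summable.of_norm_bounded (hwsum.mul_left C) fun s => hdom s
  have hrsum' : Summable (fun s : Λ => ‖r s‖) :=
    (htsum.mul_left C).of_nonneg_of_le (fun _ => norm_nonneg _) fun s => hr_le s
  have hrsum : Summable (fun s : Λ => r s) := hrsum'.of_norm
  have hgsum : Summable (fun s : Λ => g s) := by
    have e : (fun s : Λ => g s) = fun s : Λ => f s - r s := by ext s; simp [hr]
    rw [e]
    exact hfsum.sub hrsum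
  have hΛtail : ‖∑' s : Λ, r s‖ ≤ C * η' :=
    calc ‖∑' s : Λ, r s‖ ≤ ∑' s : Λ, ‖r s‖ := norm_tsum_le_tsum_norm hrsum'
      _ ≤ ∑' s : Λ, C * t s := hrsum'.tsum_le_tsum (fun s => hr_le s) (htsum.mul_left C)
      _ = C * ∑' s : Λ, t s := tsum_mul_left
      _ ≤ C * η' := by gcongr
  -- the compactly supported part
  have hgt := tendsto_sum_of_near_of_hasCompactSupport z Λ hδ hsep hΛ h hgc hgs
  obtain ⟨K, hK⟩ := Metric.tendsto_atTop.1 hgt η' hη'0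
  refine ⟨K, fun k hk => ?_⟩
  have hdec : ∑' s : Λ, f s = ∑' s : Λ, g s + ∑' s : Λ, r s := by
    rw [← hgsum.tsum_add hrsum]
    exact tsum_congr fun s => by simp [hr]
  have hdeck : ∑ i, f (z k i) = ∑ i, g (z k i) + ∑ i, r (z k i) := by
    rw [← Finset.sum_add_distrib]
    exact Finset.sum_congr rfl fun i _ => by simp [hr]
  have hK' := hK k hk
  rw [dist_eq_norm] at hK' ⊢
  rw [hdec, hdeck]
  have hCη : η' * (2 * C + 2) = η := by rw [hη']; field_simp
  calc ‖∑ i, g (z k i) + ∑ i, r (z k i) - (∑' s : Λ, g s + ∑' s : Λ, r s)‖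
      = ‖(∑ i, g (z k i) - ∑' s : Λ, g s) + ∑ i, r (z k i) - ∑' s : Λ, r s‖ := by
        congr 1; abel
    _ ≤ ‖(∑ i, g (z k i) - ∑' s : Λ, g s) + ∑ i, r (z k i)‖ + ‖∑' s : Λ, r s‖ := norm_sub_le _ _
    _ ≤ ‖∑ i, g (z k i) - ∑' s : Λ, g s‖ + ‖∑ i, r (z k i)‖ + ‖∑' s : Λ, r s‖ := by
        gcongr; exact norm_add_le _ _
    _ < η' + C * η' + C * η' := by linarith [hfin_tail k, hΛtail, hK']
    _ ≤ η := by nlinarith [hCη, hη'0]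

end HcpRigidityLocalLimit

/-- **Registered helper stub of `stub_localLimitTransfer` (Aux file 1): local convergence of
Gaussian-dominated sums.** If `δ`-separated finite configurations `z k` of `ℝ³` converge locally
(two-way `ε`-matching on every ball about `0`, eventually in `k`) to a `δ`-separated set `Λ`, then
`∑ᵢ f(z k i) → ∑' s : Λ, f s` for every continuous `f : ℝ³ → ℂ` with `‖f x‖ ≤ C e^{-|x|²/L²}`
(`L > 0`). [folklore] -/
theorem stub_localLimitTransferGaussDominated : ∀ (δ : ℝ), 0 < δ → ∀ (m : ℕ → ℕ) (z : (k : ℕ) → (Fin (m k) → EuclideanSpace ℝ (Fin 3))) (Λ : Set (EuclideanSpace ℝ (Fin 3))), (∀ (k : ℕ) (i i' : Fin (m k)), i ≠ i' → δ ≤ dist (z k i) (z k i')) → (∀ p ∈ Λ, ∀ q ∈ Λ, p ≠ q → δ ≤ dist p q) → (∀ R ε : ℝ, 0 < ε → ∀ᶠ k : ℕ in Filter.atTop, (∀ p ∈ Λ, ‖p‖ ≤ R → ∃ i : Fin (m k), dist (z k i) p ≤ ε) ∧ (∀ i : Fin (m k), ‖z k i‖ ≤ R → ∃ p ∈ Λ,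 dist (z k i) p ≤ ε)) → ∀ (L C : ℝ), 0 < L → ∀ f : EuclideanSpace ℝ (Fin 3) → ℂ, Continuous f → (∀ x : EuclideanSpace ℝ (Fin 3), ‖f x‖ ≤ C * Real.exp (-(‖x‖ ^ 2) / L ^ 2)) → Filter.Tendsto (fun k : ℕ => ∑ i : Fin (m k), f (z k i)) Filter.atTop (nhds (∑' s : Λ, f (s : EuclideanSpace ℝ (Fin 3)))) :=
  fun _ hδ _ z Λ hsep hΛ h _ _ hL _ hfc hdom =>
    HcpRigidityLocalLimit.tendsto_sum_of_near_of_gauss z Λ hδ hsep hΛ h hL hfc hdom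

end Summit.AtomisticToContinuum.Crystallization.Theorems

end
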